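import Summits.RiemannHypothesis.RiemannHypothesis.Theses.RuelleBand
import Literature.Barriers.RiemannHypothesis.DavenportHeilbronnEuler
import Literature.Barriers.RiemannHypothesis.DavenportHeilbronnSaiasWeingartnerHolds

/-!
# `AsymptoticCriticalLine` (crux `stmt-RiemannHypothesis-2063`, route `RuelleBand`):
# the band SHAPE fails for the Davenport–Heilbronn function (negative-side support)

Support file of the crux disprover (cdisprove seat refuter-cdisprove-stmt-RiemannHypothesis-2063-0),
companion of `BandForms.lean` and `ShapeFails.lean`. The crux says that for every `ε > 0` the band
`{s | ζ s = 0 ∧ 0 < Re s ∧ Re s < 1 ∧ ε ≤ |Re s − 1/2|}` is finite. Here the same shape is REFUTED,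
unconditionally, for the Davenport–Heilbronn function `f` (Titchmarsh §10.25;
`Literature.Barriers.RiemannHypothesis.davenportHeilbronn`): an entire Dirichlet series with
`5`-periodic coefficients, a Riemann-type (odd, conductor `5`) functional equation and infinitely
many zeros ON the critical line (tree: `davenportHeilbronn_zeros_on_critical_line_infinite`), which
nevertheless has `≥ cT` zeros with `3/4 < Re s < 1`, `|Im s| ≤ T` for all large `T`
(`not_band_davenportHeilbronn`). Ingredients, all proved: Titchmarsh's character `χ₁` mod `5` as a
`DirichletCharacter` (`chi1Char`, values `chi1Val`), the decomposition
`f = c·L(·,χ₁) + c̄·L(·,χ̄₁)` at the level of continued functions (`davenportHeilbronn_eq_comb`, from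
the tree's `davenportHeilbronn_eq_LFunction` and `dhCoeff_eq`), and the tree's PROVED
Saias–Weingartner theorem `SaiasWeingartner_holds` applied to the family `{(c, χ₁), (c̄, χ̄₁)}`.
Consequence for the crux: functional equation + critical-line zeros + Dirichlet series with periodic
coefficients do not yield the band statement; the barrier
`Literature.Barriers.RiemannHypothesis.DavenportHeilbronnNarrow` bites on `AsymptoticCriticalLine`,
not only on RH.
-/

noncomputable section

namespace Summit.RiemannHypothesis.RiemannHypothesis.Theorems.AsymptoticCriticalLine.Negative

open Complex Set
open Literature.Barriers.RiemannHypothesis (davenportHeilbronn dhCoeff chi1Val chi1Val_natCast_mul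
  dhC dhCoeff_eq davenportHeilbronn_eq_LFunction dhC_re)

/-! ## The Davenport–Heilbronn function violates the band shape (unconditional) -/

/-- Titchmarsh's character `χ₁` mod `5` (`χ₁(2) = i`) as a Dirichlet character (values
`Literature.Barriers.RiemannHypothesis.chi1Val = (0, 1, i, −i, −1)`). [cite: Titchmarsh1986, §10.25] -/
def chi1Char : DirichletCharacter ℂ 5 where
  toFun := chi1Val
  map_one' := by simp [chi1Val]
  map_mul' a b := by
    conv_lhs => rw [← ZMod.natCast_zmod_val a, ← ZMod.natCast_zmod_val b, ← Nat.cast_mul]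
    rw [chi1Val_natCast_mul, ZMod.natCast_zmod_val, ZMod.natCast_zmod_val]
  map_nonunit' a ha := by
    fin_cases a
    · simp [chi1Val]
    all_goals exact absurd (by decide) ha

/-- [folklore] -/
theorem chi1Char_apply (a : ZMod 5) : chi1Char a = chi1Val a := rfl

/-- The conjugate character `χ̄₁ = χ₂` (`χ̄₁(2) = −i`). [cite: Titchmarsh1986, §10.25] -/
def chi1BarChar : DirichletCharacter ℂ 5 :=
  chi1Char.ringHomComp (starRingEnd ℂ)

/-- [folklore] -/
theorem chi1BarChar_apply (a : ZMod 5) : chi1BarChar a = starRingEnd ℂ (chi1Val a) := rfl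

/-- [folklore] -/
theorem chi1Char_two : chi1Char 2 = I := by
  rw [chi1Char_apply]; simp [chi1Val]

/-- [folklore] -/
theorem chi1BarChar_two : chi1BarChar 2 = -I := by
  rw [chi1BarChar_apply]; simp [chi1Val]

/-- [folklore] -/
theorem one_apply_two : (1 : DirichletCharacter ℂ 5) 2 = 1 :=
  MulChar.one_apply (show IsUnit (2 : ZMod 5) by decide)

/-- A non-trivial character mod `5` is primitive. [folklore] -/
theorem isPrimitive_of_ne_one_five {χ : DirichletCharacter ℂ 5} (hχ : χ ≠ 1) : χ.IsPrimitive := by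
  rw [DirichletCharacter.isPrimitive_def]
  rcases (Nat.dvd_prime Nat.prime_five).mp χ.conductor_dvd_level with h1 | h1
  · exact absurd ((DirichletCharacter.eq_one_iff_conductor_eq_one (χ := χ)).mpr h1) hχ
  · exact h1

/-- [folklore] -/
theorem chi1Char_ne_one : chi1Char ≠ 1 := by
  intro h
  have h2 := congrArg (fun χ : DirichletCharacter ℂ 5 => (χ 2).re) h
  simp only [chi1Char_two, one_apply_two, I_re, one_re] at h2
  norm_num at h2

/-- [folklore] -/
theorem chi1BarChar_ne_one : chi1BarChar ≠ 1 := by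
  intro h
  have h2 := congrArg (fun χ : DirichletCharacter ℂ 5 => (χ 2).re) h
  simp only [chi1BarChar_two, one_apply_two, neg_re, I_re, one_re] at h2
  norm_num at h2

/-- [folklore] -/
theorem chi1Char_ne_chi1BarChar : chi1Char ≠ chi1BarChar := by
  intro h
  have h2 := congrArg (fun χ : DirichletCharacter ℂ 5 => (χ 2).im) h
  simp only [chi1Char_two, chi1BarChar_two, neg_im, I_im] at h2
  norm_num at h2

/-- The family `{χ₁, χ̄₁}`. [folklore] -/
def dhChar : Bool → DirichletCharacter ℂ 5 := fun b => cond b chi1BarChar chi1Char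

/-- The weights `c = (1 − i tan θ)/2` and `c̄`. [folklore] -/
def dhWeight : Bool → ℂ := fun b => cond b (starRingEnd ℂ dhC) dhC

/-- [folklore] -/
theorem dhC_ne_zero : dhC ≠ 0 := fun h => by
  have := congrArg re h
  rw [dhC_re, zero_re] at this
  norm_num at this

/-- [folklore] -/
theorem dhWeight_ne_zero (b : Bool) : dhWeight b ≠ 0 := by
  cases b
  · exact dhC_ne_zero
  · exact (map_ne_zero (starRingEnd ℂ)).2 dhC_ne_zero

/-- Congruence `L`-functions are linear in the coefficient function. [folklore] -/
theorem ZMod_LFunction_linear {N : ℕ} [NeZero N] (a b : ℂ) (Φ Ψ : ZMod N → ℂ) (s : ℂ) :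
    ZMod.LFunction (fun j => a * Φ j + b * Ψ j) s = a * ZMod.LFunction Φ s + b * ZMod.LFunction Ψ s := by
  simp only [ZMod.LFunction, Finset.mul_sum, Finset.sum_add_distrib, add_mul, mul_add]
  congr 1 <;> refine Finset.sum_congr rfl fun j _ => ?_ <;> ring

/-- `f = c·L(·,χ₁) + c̄·L(·,χ̄₁)` — Titchmarsh's `f = ½ sec θ (e^{−iθ}L₁ + e^{iθ}L₂)` at the level
of continued functions (tree: `davenportHeilbronn_eq_LFunction`, `dhCoeff_eq`). [cite: Titchmarsh1986, §10.25] -/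
theorem davenportHeilbronn_eq_comb (s : ℂ) :
    davenportHeilbronn s = dhC * chi1Char.LFunction s + starRingEnd ℂ dhC * chi1BarChar.LFunction s := by
  rw [davenportHeilbronn_eq_LFunction, DirichletCharacter.LFunction, DirichletCharacter.LFunction,
    ← ZMod_LFunction_linear]
  congr 1
  funext j
  rw [dhCoeff_eq, chi1Char_apply, chi1BarChar_apply]

/-- The Saias–Weingartner sum for the family `{(c, χ₁), (c̄, χ̄₁)}` IS `f`. [folklore] -/
theorem dh_sum_eq (s : ℂ) :
    ∑ b : Bool, LSeries (dhWeight b • LSeries.delta) s * (dhChar b).LFunction s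
      = davenportHeilbronn s := by
  rw [Fintype.sum_bool, davenportHeilbronn_eq_comb]
  simp only [dhWeight, dhChar, cond_true, cond_false, LSeries_smul, LSeries_delta, Pi.one_apply,
    mul_one]
  ring

/-- Both members of the family are primitive. [folklore] -/
theorem dhChar_isPrimitive : ∀ b : Bool, (dhChar b).IsPrimitive
  | false => isPrimitive_of_ne_one_five chi1Char_ne_one
  | true => isPrimitive_of_ne_one_five chi1BarChar_ne_one

/-- The two members are distinct characters. [folklore] -/
theorem dhSigma_injective :
    Function.Injective (fun b ↦ (⟨5, dhChar b⟩ : Σ n, DirichletCharacter ℂ n)) := by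
  intro a b hab
  simp only [Sigma.mk.injEq, heq_eq_eq, true_and] at hab
  cases a <;> cases b
  · rfl
  · exact absurd hab chi1Char_ne_chi1BarChar
  · exact absurd hab.symm chi1Char_ne_chi1BarChar
  · rfl

/-- The Dirichlet polynomials `c·1`, `c̄·1` are finitely supported and non-zero. [folklore] -/
theorem dhP_ok (b : Bool) :
    (Function.support (dhWeight b • LSeries.delta)).Finite ∧
      ∃ n, n ≠ 0 ∧ (dhWeight b • LSeries.delta) n ≠ 0 := by
  refine ⟨(Set.finite_singleton 1).subset fun n hn => ?_, 1, one_ne_zero, ?_⟩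
  · rw [Set.mem_singleton_iff]
    by_contra h
    exact hn (by simp [LSeries.delta, h])
  · simp [LSeries.delta, dhWeight_ne_zero]

/-- REFUTED STRENGTHENING (unconditional): the band shape fails for the Davenport–Heilbronn
function `f` itself — entire, `5`-periodic Dirichlet coefficients, Riemann-type (odd, conductor `5`)
functional equation, infinitely many zeros ON the critical line (tree:
`davenportHeilbronn_zeros_on_critical_line_infinite`) — yet `≥ cT` zeros with `3/4 < Re s < 1`,
`|Im s| ≤ T` (Saias–Weingartner Thm 2, tree `SaiasWeingartner_holds`; for `f` originally Voronin).
Functional equation + critical zeros + Dirichlet series do not give the band: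
barrier `Literature.Barriers.RiemannHypothesis.DavenportHeilbronnNarrow` bites on the crux. [folklore] -/
theorem not_band_davenportHeilbronn :
    ¬ ∀ ε : ℝ, 0 < ε →
      {s : ℂ | davenportHeilbronn s = 0 ∧ 0 < s.re ∧ s.re < 1 ∧ ε ≤ |s.re - 1 / 2|}.Finite := by
  intro hband
  obtain ⟨η, hη, hstrip⟩ :=
    Literature.Barriers.RiemannHypothesis.SaiasWeingartner_holds Bool (fun _ => 5) dhChar
      (fun b => dhWeight b • LSeries.delta) (by simp) dhChar_isPrimitive dhSigma_injective dhP_ok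
  obtain ⟨c, hc, T₀, hT⟩ := hstrip (3 / 4) 1 (by norm_num) (by norm_num) (by linarith)
  have hfin := hband (1 / 4) (by norm_num)
  set N : ℕ := hfin.toFinset.card with hN
  obtain ⟨Z, hZcard, hZ⟩ := hT (max T₀ (((N : ℝ) + 1) / c)) (le_max_left _ _)
  have hZsub : ∀ s ∈ Z,
      s ∈ {s : ℂ | davenportHeilbronn s = 0 ∧ 0 < s.re ∧ s.re < 1 ∧ 1 / 4 ≤ |s.re - 1 / 2|} := by
    intro s hs
    obtain ⟨h1, h2, _, h4⟩ := hZ s hs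
    rw [dh_sum_eq] at h4
    refine ⟨h4, by linarith, h2, ?_⟩
    rw [abs_of_pos (by linarith)]
    linarith
  have hcard : Z.card ≤ N :=
    Finset.card_le_card fun s hs => (Set.Finite.mem_toFinset hfin).2 (hZsub s hs)
  have hge : (N : ℝ) + 1 ≤ c * max T₀ (((N : ℝ) + 1) / c) :=
    calc (N : ℝ) + 1 = c * (((N : ℝ) + 1) / c) := by field_simp
      _ ≤ c * max T₀ (((N : ℝ) + 1) / c) := by gcongr; exact le_max_right _ _
  have h1 : (N : ℝ) + 1 ≤ Z.card := hge.trans hZcard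
  have h2 : (Z.card : ℝ) ≤ N := by exact_mod_cast hcard
  linarith

end Summit.RiemannHypothesis.RiemannHypothesis.Theorems.AsymptoticCriticalLine.Negative
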